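import Summits.QuantumFields.YangMills.Theorems.ColdStartUniversalityLatticeLangevinWilsonAutocorrelationLogConvex
import HarnessLib

/-!
# Route `ColdStartUniversality` (fixed-cut-off `L²(μ_{β'})` package): `L²` CONTRACTION AT ONE TIME IS A SPECTRAL GAP —
# `Var_μ(κ_{h₀} H) ≤ e^{−2λh₀} Var_μ(H)` for all continuous `H` at ONE lattice time `h₀` ⇒ the same at EVERY time, same rate

Helper file (seat `ym-line-csu-p1`, g17; `--supports stmt-QuantumFields-27363`).  Fifth part of the semigroup-form Poincaré package.
By the spectral theorem, `‖P_{h₀}‖_{L²₀ → L²₀} ≤ e^{−λh₀}` at one time is the spectral gap `λ`; here this is kernel-checked for the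
reversible SZZ kernels WITHOUT spectral theory, from the discrete log-convexity of `u ↦ Φ_G(u) = ⟨G₀, κ_u G₀⟩_μ`
(`integral_mul_transition_nat_mul_ge`: on the grid `T = 2h₀/N` the first ratio `q = Φ(T)/Φ(0)` is the smallest, so
`q^N ≤ Φ(2h₀)/Φ(0) ≤ e^{−2λh₀}`, i.e. `q ≤ e^{−λT}` and `𝓔_T(G) = (1 − q)Φ(0)/T ≥ (1 − e^{−λT})/T · Var(G) → λ Var(G)`):

* ★★ `semigroupPoincare_of_contraction_at` — one-time contraction at rate `λ` ⇒ the semigroup-form Poincaré inequality with constant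
  `1/λ` on `C(X)` (`η`-form);
* ★★ `integral_sq_transition_sub_le_exp_of_contraction_at` — hence `∫ (κ_t G − μG)² dμ ≤ e^{−2λt} Var_μ(G)` for EVERY `t`
  (`integral_sq_transition_sub_le_exp_of_semigroupPoincare`).  Reading with `θ = e^{−2λh₀}`: a uniform bound `θ < 1` on the normalised
  stationary autocovariance `⟨G₀, κ_{2h₀} G₀⟩/Var(G)` of ALL continuous observables at ONE lag is the gap `−log θ/(2h₀)`.

So at fixed cut-off four formulations coincide with the same constant, all kernel-checked by convexity alone: `L²` decay at rate `λ`
for all times ⟺ at one time ⟺ semigroup-form Poincaré(`1/λ`) ⟺ `sup_G τ_int(G) ≤ 1/λ` (`…AutocorrelationToGap`).  THEOREMS ONLY, no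
definition, no sorry.  HONEST FRAMING: RECORD-rung R3 plumbing at FIXED cut-off (K-uniform reading in `…UniformColdStartMixingOfAutocorrelationTime`);
nothing K-uniform is proved; no crux, rung or summit statement is proved; the Yang–Mills mass gap is NOT proved.
-/

set_option autoImplicit false

noncomputable section

namespace Summit.QuantumFields.YangMills.Theorems.ColdStartUniversality

open MeasureTheory ProbabilityTheory Filter Set Topology Finset
open scoped BigOperators NNReal ENNReal
open Literature.Probability.Process Literature.MathematicalPhysics.QuantumFieldTheory
open Literature.MathematicalPhysics.QuantumLattice (fundamentalRep fundamentalLatticeRep continuous_fundamentalRep)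

variable {L : ℕ} [NeZero L]

/-- **The slope of `u ↦ 1 − e^{−λu}` at `0⁺` is `λ`**: `(1 − e^{−λu})/u → λ` as `u ↓ 0`. [folklore] -/
theorem tendsto_one_sub_exp_neg_mul_div (lam : ℝ) :
    Tendsto (fun u : ℝ => (1 - Real.exp (-lam * u)) / u) (𝓝[>] 0) (𝓝 lam) := by
  have hderiv : HasDerivAt (fun u : ℝ => 1 - Real.exp (-lam * u)) lam 0 := by
    have h1 : HasDerivAt (fun u : ℝ => -lam * u) (-lam) 0 := by
      simpa using (hasDerivAt_id (0 : ℝ)).const_mul (-lam)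
    have h2 : HasDerivAt (fun u : ℝ => Real.exp (-lam * u)) (Real.exp (-lam * 0) * (-lam)) 0 := h1.exp
    have h3 := (hasDerivAt_const (0 : ℝ) (1 : ℝ)).sub h2
    simp only [mul_zero, Real.exp_zero, one_mul, zero_sub, neg_neg] at h3
    exact h3
  have h := hderiv.tendsto_slope_zero_right
  refine h.congr' ?_
  filter_upwards [self_mem_nhdsWithin] with u hu
  simp only [zero_add, mul_zero, Real.exp_zero, sub_self, sub_zero, smul_eq_mul]
  rw [div_eq_inv_mul]

/-- ★★ **`L²` contraction at ONE time ⇒ Poincaré for the semigroup Dirichlet form, same rate.**  If for one lattice time `h₀ > 0`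
every continuous `H` satisfies `∫ (κ_{h₀} H − μH)² dμ_{β'} ≤ e^{−2λh₀} Var_μ(H)`, then every continuous `G` satisfies, for every
`η > 0`, `(λ − η) Var_μ(G) ≤ h⁻¹ (∫ G² dμ − ∫ G κ_h G dμ)` for some `h > 0` (grid `T = 2h₀/N`: `q = Φ(T)/Φ(0) ≤ e^{−λT}` by
`integral_mul_transition_nat_mul_ge`, and `(1 − e^{−λT})/T → λ`). [cite: BakryGentilLedoux2014, Thm 4.2.5 and Lemma 4.2.6] -/
theorem semigroupPoincare_of_contraction_at (L : ℕ) [NeZero L] (β' : ℝ)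
    (κ : ℝ≥0 → Kernel (GaugeConfig 3 L (Matrix.specialUnitaryGroup (Fin 2) ℂ))
      (GaugeConfig 3 L (Matrix.specialUnitaryGroup (Fin 2) ℂ))) [∀ t, IsMarkovKernel (κ t)]
    (hreal : ∀ (t : ℝ≥0) (x : GaugeConfig 3 L (Matrix.specialUnitaryGroup (Fin 2) ℂ))
        (Ω : Type) [MeasurableSpace Ω] (P : Measure Ω) [IsProbabilityMeasure P]
        (W : ℝ≥0 → Ω → (Edge 3 L × NoiseIdx 2 → ℝ)) (hW : IsFlatBrownian W P)
        (U : ℝ≥0 → Ω → GaugeConfig 3 L (Matrix.specialUnitaryGroup (Fin 2) ℂ)),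
        (∀ ω, U 0 ω = x) →
        (latticeLangevinDynamics (fundamentalLatticeRep 2) β').IsSolution (fundamentalRep (Fin 2))
          hW.natFiltration P W U →
        κ t x = P.map (U t))
    {h₀ : ℝ≥0} (hh₀ : 0 < h₀) {lam : ℝ}
    (hC : ∀ H : GaugeConfig 3 L (Matrix.specialUnitaryGroup (Fin 2) ℂ) → ℝ, Continuous H →
      ∫ x, ((∫ y, H y ∂(κ h₀ x)) - ∫ z, H z ∂(wilsonMeasure (d := 3) (L := L) (fundamentalRep (Fin 2)) β')) ^ 2
          ∂(wilsonMeasure (d := 3) (L := L) (fundamentalRep (Fin 2)) β') ≤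
        Real.exp (-2 * lam * h₀) *
          ∫ x, (H x - ∫ z, H z ∂(wilsonMeasure (d := 3) (L := L) (fundamentalRep (Fin 2)) β')) ^ 2
            ∂(wilsonMeasure (d := 3) (L := L) (fundamentalRep (Fin 2)) β'))
    {G : GaugeConfig 3 L (Matrix.specialUnitaryGroup (Fin 2) ℂ) → ℝ} (hG : Continuous G) {η : ℝ} (hη : 0 < η) :
    ∃ h : ℝ≥0, 0 < h ∧
      (lam - η) * ∫ x, (G x - ∫ z, G z ∂(wilsonMeasure (d := 3) (L := L) (fundamentalRep (Fin 2)) β')) ^ 2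
          ∂(wilsonMeasure (d := 3) (L := L) (fundamentalRep (Fin 2)) β') ≤
        (h : ℝ)⁻¹ * ((∫ x, G x * G x ∂(wilsonMeasure (d := 3) (L := L) (fundamentalRep (Fin 2)) β')) -
          ∫ x, G x * (∫ y, G y ∂(κ h x)) ∂(wilsonMeasure (d := 3) (L := L) (fundamentalRep (Fin 2)) β')) := by
  classical
  haveI := secondCountableTopology_su2
  haveI := borelSpace_config L
  set μ : Measure (GaugeConfig 3 L (Matrix.specialUnitaryGroup (Fin 2) ℂ)) :=
    wilsonMeasure (d := 3) (L := L) (fundamentalRep (Fin 2)) β' with hμ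
  haveI : IsProbabilityMeasure μ :=
    isProbabilityMeasure_wilsonMeasure (d := 3) (L := L) (fundamentalRep (Fin 2)) (continuous_fundamentalRep (Fin 2)) β'
  set m : ℝ := ∫ z, G z ∂μ with hm
  set Vr : ℝ := ∫ x, (G x - m) ^ 2 ∂μ with hVr
  have hVr0 : 0 ≤ Vr := integral_nonneg fun x => sq_nonneg _
  -- trivial cases
  by_cases htriv : (lam - η) * Vr ≤ 0
  · exact ⟨1, one_pos, htriv.trans (dirichletScale_nonneg L β' κ hreal 1 hG)⟩
  have hVpos : 0 < Vr := by
    rcases hVr0.lt_or_eq with h | h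
    · exact h
    · exfalso; apply htriv; rw [← h, mul_zero]
  have hlam : 0 < lam := by
    by_contra hle
    apply htriv
    exact mul_nonpos_of_nonpos_of_nonneg (by linarith) hVr0
  -- the centred observable and its autocorrelation function
  set G₀ : GaugeConfig 3 L (Matrix.specialUnitaryGroup (Fin 2) ℂ) → ℝ := fun x => G x - m with hG₀
  have hG₀c : Continuous G₀ := hG.sub continuous_const
  have hG₀x : ∀ x, G₀ x = G x - m := fun x => rfl
  obtain ⟨M, hM0, hM⟩ := exists_abs_le_of_continuous hG
  have hGi : ∀ (ν : Measure (GaugeConfig 3 L (Matrix.specialUnitaryGroup (Fin 2) ℂ))) [IsProbabilityMeasure ν],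
      Integrable G ν := fun ν _ =>
    Integrable.of_bound hG.aestronglyMeasurable M (Eventually.of_forall fun z => by rw [Real.norm_eq_abs]; exact hM z)
  have hκG₀ : ∀ (u : ℝ≥0) x, ∫ y, G₀ y ∂(κ u x) = (∫ y, G y ∂(κ u x)) - m := by
    intro u x
    simp only [hG₀]
    rw [integral_sub (hGi _) (integrable_const m), integral_const, probReal_univ, one_smul]
  set Φ : ℝ≥0 → ℝ := fun u => ∫ x, G₀ x * (∫ y, G₀ y ∂(κ u x)) ∂μ with hΦ
  have hΦc : Continuous Φ := continuous_integral_mul_transition L β' κ hreal hG₀c hG₀c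
  have hκ0 : κ 0 = Kernel.id := transitionKernel_zero_eq_id L β' κ hreal
  have hG₀sq : ∫ x, G₀ x * G₀ x ∂μ = Vr := integral_congr_ae (Eventually.of_forall fun x => by simp only [hG₀]; ring)
  have hΦ0pos : 0 < ∫ x, G₀ x * G₀ x ∂μ := by rw [hG₀sq]; exact hVpos
  have hΦnn : ∀ u, 0 ≤ Φ u := fun u => integral_mul_transition_self_nonneg L β' κ hreal u hG₀c
  -- the hypothesis at `G`: `Φ (h₀ + h₀) ≤ e^{−2λh₀} Vr`
  have hC2 : Φ (h₀ + h₀) ≤ Real.exp (-2 * lam * h₀) * Vr := by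
    have h := hC G hG
    have e : ∫ x, ((∫ y, G y ∂(κ h₀ x)) - m) ^ 2 ∂μ = Φ (h₀ + h₀) := by
      simp only [hΦ]
      rw [integral_mul_transition_self_eq_sq L β' κ hreal h₀ hG₀c]
      exact integral_congr_ae (Eventually.of_forall fun x => by simp only [hκG₀ h₀ x])
    rw [e] at h
    exact h
  -- the grids `T_N = 2h₀/(N+1)` and the bound `q_N ≤ e^{−λ T_N}`
  have hgrid : ∀ N : ℕ, Φ ((h₀ + h₀) / ((N : ℝ≥0) + 1)) ≤ Real.exp (-lam * (((h₀ + h₀) / ((N : ℝ≥0) + 1) : ℝ≥0) : ℝ)) * Vr := by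
    intro N
    set T : ℝ≥0 := (h₀ + h₀) / ((N : ℝ≥0) + 1) with hT
    have hN1 : ((N : ℝ≥0) + 1) ≠ 0 := by positivity
    have hNT : (((N + 1 : ℕ) : ℝ≥0)) * T = h₀ + h₀ := by
      rw [hT]; push_cast; rw [mul_div_cancel₀ _ hN1]
    -- `Vr q^{N+1} ≤ Φ((N+1)T) = Φ(2h₀) ≤ e^{−2λh₀} Vr`
    have hlow := integral_mul_transition_nat_mul_ge L β' κ hreal T hG₀c hΦ0pos (N + 1)
    rw [hNT, hG₀sq] at hlow
    have hq0 : 0 ≤ Φ T / Vr := div_nonneg (hΦnn T) hVr0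
    have hchain : (Φ T / Vr) ^ (N + 1) ≤ Real.exp (-2 * lam * h₀) := by
      have h1 : Vr * (Φ T / Vr) ^ (N + 1) ≤ Real.exp (-2 * lam * h₀) * Vr := hlow.trans hC2
      have h2 : Vr * (Φ T / Vr) ^ (N + 1) ≤ Vr * Real.exp (-2 * lam * h₀) := by linarith
      exact le_of_mul_le_mul_left h2 hVpos
    -- the root: `r = e^{−λT}` has `r^{N+1} = e^{−2λh₀}`
    set r : ℝ := Real.exp (-lam * (T : ℝ)) with hr
    have hrpow : r ^ (N + 1) = Real.exp (-2 * lam * h₀) := by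
      rw [hr, ← Real.exp_nat_mul]
      congr 1
      have hTreal : (T : ℝ) = ((h₀ : ℝ) + h₀) / ((N : ℝ) + 1) := by
        rw [hT]; push_cast; ring
      rw [hTreal]; field_simp; push_cast; ring
    have hqr : Φ T / Vr ≤ r := by
      by_contra hcon
      have hlt : r < Φ T / Vr := lt_of_not_ge hcon
      have : r ^ (N + 1) < (Φ T / Vr) ^ (N + 1) := pow_lt_pow_left₀ hlt (Real.exp_pos _).le (Nat.succ_ne_zero N)
      linarith [hchain, hrpow ▸ this]
    have := mul_le_mul_of_nonneg_right hqr hVr0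
    rwa [div_mul_cancel₀ _ hVpos.ne'] at this
  -- choose `N` with `(1 − e^{−λ T_N})/T_N ≥ λ − η`
  have hTseq : Tendsto (fun N : ℕ => (((h₀ + h₀) / ((N : ℝ≥0) + 1) : ℝ≥0) : ℝ)) atTop (𝓝[>] 0) := by
    have e : ∀ N : ℕ, (((h₀ + h₀) / ((N : ℝ≥0) + 1) : ℝ≥0) : ℝ) = ((h₀ : ℝ) + h₀) * (1 / ((N : ℝ) + 1)) := by
      intro N; push_cast; ring
    simp_rw [e]
    refine tendsto_nhdsWithin_iff.2 ⟨?_, Eventually.of_forall fun N => ?_⟩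
    · have h := (tendsto_one_div_add_atTop_nhds_zero_nat).const_mul ((h₀ : ℝ) + h₀)
      rw [mul_zero] at h
      exact h
    · have : (0 : ℝ) < h₀ := by exact_mod_cast hh₀
      show (0 : ℝ) < ((h₀ : ℝ) + h₀) * (1 / ((N : ℝ) + 1))
      positivity
  have hslope := (tendsto_one_sub_exp_neg_mul_div lam).comp hTseq
  have hev : ∀ᶠ N : ℕ in atTop, lam - η <
      (1 - Real.exp (-lam * (((h₀ + h₀) / ((N : ℝ≥0) + 1) : ℝ≥0) : ℝ))) / (((h₀ + h₀) / ((N : ℝ≥0) + 1) : ℝ≥0) : ℝ) :=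
    hslope.eventually (eventually_gt_nhds (by linarith))
  obtain ⟨N, hN⟩ := hev.exists
  set T : ℝ≥0 := (h₀ + h₀) / ((N : ℝ≥0) + 1) with hT
  have hTpos : (0 : ℝ) < T := by
    have : (0 : ℝ) < h₀ := by exact_mod_cast hh₀
    rw [hT]; push_cast; positivity
  refine ⟨T, by exact_mod_cast hTpos, ?_⟩
  -- assemble: `(λ − η) Vr ≤ (1 − e^{−λT})/T · Vr ≤ (Vr − Φ T)/T = 𝓔_T(G)`
  have hgT : Φ T ≤ Real.exp (-lam * (T : ℝ)) * Vr := hgrid N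
  rw [dirichletScale_eq_centred L β' κ hreal T hG]
  have eΦT : ∫ x, (G x - m) * (∫ y, (G y - m) ∂(κ T x)) ∂μ = Φ T := rfl
  have eV : ∫ x, (G x - m) * (G x - m) ∂μ = Vr := integral_congr_ae (Eventually.of_forall fun x => by ring)
  rw [eV, eΦT]
  have h1 : (lam - η) * Vr ≤ (1 - Real.exp (-lam * (T : ℝ))) / T * Vr := mul_le_mul_of_nonneg_right hN.le hVr0
  have h2 : (1 - Real.exp (-lam * (T : ℝ))) / T * Vr ≤ (T : ℝ)⁻¹ * (Vr - Φ T) := by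
    rw [div_eq_inv_mul, mul_assoc]
    refine mul_le_mul_of_nonneg_left ?_ (inv_nonneg.2 hTpos.le)
    nlinarith [hgT]
  exact h1.trans h2

/-- ★★ **`L²` contraction at one time is a spectral gap**: if `∫ (κ_{h₀}H − μH)² dμ ≤ e^{−2λh₀} Var_μ(H)` for every continuous `H` at
ONE lattice time `h₀ > 0`, then `∫ (κ_t G − μG)² dμ ≤ e^{−2λt} Var_μ(G)` for every continuous `G` and EVERY lattice time `t`
(`semigroupPoincare_of_contraction_at` + `integral_sq_transition_sub_le_exp_of_semigroupPoincare`).  With `θ = e^{−2λh₀} < 1`: a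
uniform bound `θ` on the lag-`2h₀` normalised stationary autocovariance of all continuous observables is the `L²` rate `−log θ/(2h₀)`.
[cite: BakryGentilLedoux2014, Thm 4.2.5] -/
theorem integral_sq_transition_sub_le_exp_of_contraction_at (L : ℕ) [NeZero L] (β' : ℝ)
    (κ : ℝ≥0 → Kernel (GaugeConfig 3 L (Matrix.specialUnitaryGroup (Fin 2) ℂ))
      (GaugeConfig 3 L (Matrix.specialUnitaryGroup (Fin 2) ℂ))) [∀ t, IsMarkovKernel (κ t)]
    (hreal : ∀ (t : ℝ≥0) (x : GaugeConfig 3 L (Matrix.specialUnitaryGroup (Fin 2) ℂ))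
        (Ω : Type) [MeasurableSpace Ω] (P : Measure Ω) [IsProbabilityMeasure P]
        (W : ℝ≥0 → Ω → (Edge 3 L × NoiseIdx 2 → ℝ)) (hW : IsFlatBrownian W P)
        (U : ℝ≥0 → Ω → GaugeConfig 3 L (Matrix.specialUnitaryGroup (Fin 2) ℂ)),
        (∀ ω, U 0 ω = x) →
        (latticeLangevinDynamics (fundamentalLatticeRep 2) β').IsSolution (fundamentalRep (Fin 2))
          hW.natFiltration P W U →
        κ t x = P.map (U t))
    {h₀ : ℝ≥0} (hh₀ : 0 < h₀) {lam : ℝ}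
    (hC : ∀ H : GaugeConfig 3 L (Matrix.specialUnitaryGroup (Fin 2) ℂ) → ℝ, Continuous H →
      ∫ x, ((∫ y, H y ∂(κ h₀ x)) - ∫ z, H z ∂(wilsonMeasure (d := 3) (L := L) (fundamentalRep (Fin 2)) β')) ^ 2
          ∂(wilsonMeasure (d := 3) (L := L) (fundamentalRep (Fin 2)) β') ≤
        Real.exp (-2 * lam * h₀) *
          ∫ x, (H x - ∫ z, H z ∂(wilsonMeasure (d := 3) (L := L) (fundamentalRep (Fin 2)) β')) ^ 2
            ∂(wilsonMeasure (d := 3) (L := L) (fundamentalRep (Fin 2)) β'))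
    {G : GaugeConfig 3 L (Matrix.specialUnitaryGroup (Fin 2) ℂ) → ℝ} (hG : Continuous G) (t : ℝ≥0) :
    ∫ x, ((∫ y, G y ∂(κ t x)) - ∫ z, G z ∂(wilsonMeasure (d := 3) (L := L) (fundamentalRep (Fin 2)) β')) ^ 2
        ∂(wilsonMeasure (d := 3) (L := L) (fundamentalRep (Fin 2)) β') ≤
      Real.exp (-2 * lam * t) *
        ∫ x, (G x - ∫ z, G z ∂(wilsonMeasure (d := 3) (L := L) (fundamentalRep (Fin 2)) β')) ^ 2
          ∂(wilsonMeasure (d := 3) (L := L) (fundamentalRep (Fin 2)) β') :=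
  integral_sq_transition_sub_le_exp_of_semigroupPoincare L β' κ hreal
    (fun _ hG' _ hη => semigroupPoincare_of_contraction_at L β' κ hreal hh₀ hC hG' hη) hG t

end Summit.QuantumFields.YangMills.Theorems.ColdStartUniversality

end
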